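import Mathlib
import HarnessLib
import HarnessLib.Audit
import Summits.ValiantsHypothesis.Statement
import Literature.Computability.AlgebraicComplexity.BLMW11WeakValiantHypothesis
import Literature.Computability.AlgebraicComplexity.BLMW11ApproximationElimination
import Literature.Computability.AlgebraicComplexity.ValiantConjectureEquivProofs
import Literature.Computability.AlgebraicComplexity.DDS21BorderDepthThree
import Literature.Computability.AlgebraicComplexity.DDS21Thm32Holds
import Literature.Computability.AlgebraicComplexity.DDS21ZariskiBorderConstFaninVBP
import HarnessLib.Audit.Status.Attr

/-!
Route: DecompCycle1C

# Route DecompCycle1C — Decomposition workshop cycle 1, node C (DeborderingSquare) — VP≠VNP ⟺ four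
debordering/collapse-transfer statements over the closure of VP_ws

WORKSHOP RECORD (decomp-valiant cycle 1 = VALIANT, writer decomp-val-writer-1-g0). This file is node
C of the OR over alternative
AND-decompositions of S = `ValiantsHypothesis`; node A is route DecompCycle1 (lens-6
TameSensitivity: S ⟺ PerNotTame ∧ TamePer), node B
is DecompCycle1B (lens-4 DepthWindow: S ⟸ PerHardLog3 ∧ CollapseLog3). Node C was proposed by
decomp-val-lens-3 (NODE v1 17:44:21Z,
v1.1 17:50:31Z, v2 2026-08-29T18:14:37Z; lens file HOME/decomp-val-lens-3/DeborderingSquare.lean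
sha256 2695bff14e0daff8…, NODE.md
6455392d…, Route.md 5536c425…, certified route.json 0765349b…, glue 9f9f7175…) and CLEARED by the
critic decomp-val-crit-1 at
2026-08-29T18:15:32Z (HOME/CRITIC-LEDGER.md rows 2–3 objections O1/O2, row 8 CLEARED: O1 = residual
tags at v1.1, O2 = typed next rung
R3 BorderDepthThreeInVNP under P3 at v2) against the census HOME/census/COSTUME-CENSUS-v1.json
(sha256 90724a8468526f3e…). Per-piece
tags (critic): P1 DeborderedMulmuleySohoni — WEAKER (S ⟹ P1 kernel p1_of_vh; P1 ⟹ S unknown; implied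
by the registered STRONGER
DcPerSuperpolynomial / BorderDc…, not conversely, hence not COSTUME) · leaf INSTRUMENTABLE (finite
GCT/exact-dc rungs instrument T);
P2 CollapseToBorderDet, P3 CollapseDebordersIntoCircuits, P4 CollapseDebordersCircuitsIntoDet —
DECLARED-RESIDUAL(P1) components
(P2 ∧ P3 ∧ P4 ⟺ (P1 → S) kernel, critic_residual_iff′), each WEAKER (vacuous under S) · leaves
IDEA-NEEDED / ATTACKABLE (P3: typed rung
R3 = BorderDepthThreeInVNP, kernel-pinned U3 → R3hi → R3 → R3lo, enters as a skeleton stub, never a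
closes binder) / IDEA-NEEDED.
Statements, glue and sections below are the lens's certified v2 text, unchanged. LADDER-Valiant rung
0: nothing here proves VP ≠ VNP.

It suffices to show X = P1 ∧ P2 ∧ P3 ∧ P4 (and S ⟺ X): with VBP̄ := closure of VP_ws
(`IsVPwsBarFamily`, BLMW 2011 §9.3),
D := "VBP̄ ⊆ VBP on p-bounded variable sets" (BLMW Question 9.4.2 / Prop 9.4.3), D⁺ := "VBP̄ ⊆
p-computable",
T := VNP ⊄ VBP̄ (class form of `BorderDcPerSuperpolynomial`, Mulmuley–Sohoni in polynomial form,
BLMW Prop. 9.3.2):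
P1 = D → T (debordered Mulmuley–Sohoni); P2 = VP=VNP → VNP ⊆ VBP̄ (⟺ T → S); P3 = VP=VNP → D⁺
(⟺ a circuit lower bound for a VBP̄ family gives S); P4 = VP=VNP → (p-computable ∩ VBP̄ ⊆ VBP).
Decomposition-workshop node (decomp-valiant cycle 1, lens 3): every piece is implied by S and by a
printed-open
statement not known to imply S; no idea card realised (workshop lens output).
Lean: `((∀ (v : ℕ → ℕ) (f : ∀ n, MvPolynomial (Fin (v n)) ℂ),
Literature.Computability.AlgebraicComplexity.IsPBounded v →
Literature.Computability.AlgebraicComplexity.IsVPwsBarFamily f →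
Literature.Computability.AlgebraicComplexity.IsVPwsFamily f) → ¬ (∀ (v : ℕ → ℕ) (f : ∀ n,
MvPolynomial (Fin (v n)) ℂ), Literature.Computability.AlgebraicComplexity.IsVNPFamily f →
Literature.Computability.AlgebraicComplexity.IsVPwsBarFamily f)) ∧
(Literature.Computability.AlgebraicComplexity.VP ℂ =
Literature.Computability.AlgebraicComplexity.VNP ℂ → ∀ (v : ℕ → ℕ) (f : ∀ n, MvPolynomial (Fin (v
n)) ℂ), Literature.Computability.AlgebraicComplexity.IsVNPFamily f →
Literature.Computability.AlgebraicComplexity.IsVPwsBarFamily f) ∧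
(Literature.Computability.AlgebraicComplexity.VP ℂ =
Literature.Computability.AlgebraicComplexity.VNP ℂ → ∀ (v : ℕ → ℕ) (f : ∀ n, MvPolynomial (Fin (v
n)) ℂ), Literature.Computability.AlgebraicComplexity.IsPBounded v →
Literature.Computability.AlgebraicComplexity.IsVPwsBarFamily f →
Literature.Computability.AlgebraicComplexity.IsPComputable f) ∧
(Literature.Computability.AlgebraicComplexity.VP ℂ =
Literature.Computability.AlgebraicComplexity.VNP ℂ → ∀ (v : ℕ → ℕ) (f : ∀ n, MvPolynomial (Fin (v
n)) ℂ), Literature.Computability.AlgebraicComplexity.IsPBounded v →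
Literature.Computability.AlgebraicComplexity.IsPComputable f →
Literature.Computability.AlgebraicComplexity.IsVPwsBarFamily f →
Literature.Computability.AlgebraicComplexity.IsVPwsFamily f)`

## Assembly
Pure logic: under VP = VNP, P3 and P4 give D; P1 (class form, v2) turns D into VNP ⊄ closure(VP_ws),
contradicting P2 (the tree equivalence `borderDcPerSuperpolynomial_iff_not_vnp_subset_vpwsBar`, BLMW
Prop 9.3.2 discharged, identifies this with T = per ∉ closure(VP_ws) but is no longer needed in
`closes`). Conversely S implies each piece (P2–P4 trivially; P1 via
`dcPerSuperpolynomial_of_perNotPComputableComplex` and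
`dcPerSuperpolynomial_iff_not_vnp_subset_vpws`), so the node is an equivalence S ⟺ P1∧P2∧P3∧P4
(proved in the lens draft `node_iff`).

Rationale: WHY THIS LINE. The border axis cannot be conjoined under the summit (per ∉ closure-VP IMPLIES S, so
it is a STRONGER piece); it can be
CONDITIONED ON: debordering of determinants D is priced as the hypothesis that converts GCT's border
target T into Valiant's exact
per/det conjecture (P1 is implied by `DcPerSuperpolynomial ℂ` = VBP≠VNP, BurgisserEtAl2011 §9.2–9.3
"MS would imply VP_ws ≠ VNP but not
a priori VP ≠ VNP"), and the bridge half of the folklore split S ⟸ (VBP≠VNP) ∧ (VBP≠VNP → S) (tree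
Cruxes/ClassTransfer/DecompositionCensus
§3: "no plan on either side") is cut into three collapse-propagation statements P2, P3, P4 over the
closure class, one of which (P3) has
proved rungs in print: Grochow–Mulmuley–Qiao arXiv:1605.02815 Thm 1/Thm 6 (p-definable degenerations
of determinants are in VNP),
Lemma 4.3, Thm 7, with the exact residual "VBP̄ ⊆ VBP*" (their Question 4.4(4)). Imported area:
geometric invariant theory /
orbit-closure degenerations (Hilbert–Mumford–Kempf in complexity-theoretic form, GMQ16 §4.1) and the
de-bordering theorems of
Dutta–Dwivedi–Saxena 2021 (FOCS) / Forbes 2016 / BDI21 as the model of D⁺. What it does that prior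
routes do not: no route of the summit
carries a debordering hypothesis or a collapse-to-border statement as an item (GCTMult,
BorderApolarity attack the STRONGER
quasi-polynomial border statements); negatives index (32 entries) has no closure-class statement.

RANKED CRUXES. #2 DeborderedMulmuleySohoni (crux) — P1 — if approximation is unnecessary for
determinants on p-bounded variable sets (closure of VP_ws ⊆ VP_ws) then VNP ⊄ closure of VP_ws
(class form of the Mulmuley–Sohoni conjecture in polynomial form; ⟺ per ∉ closure of VP_ws by the
proved BLMW Prop. 9.3.2, tree `borderDcPerSuperpolynomial_iff_not_vnp_subset_vpwsBar`). [difficulty: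
open-problem] (why it might fail: it cannot be refuted short of per ∈ VBP; it fails to CLOSE because
given D its content is Valiant's exact per/det conjecture (dc(per_m) superpolynomial; best known
m²/2, Mignon–Ressayre).) [BurgisserEtAl2011, arXiv:0907.2850, MignonRessayre2004, arXiv:1605.02815]
#3 CollapseToBorderDet (crux) — P2 — under the collapse VP = VNP every VNP family lies in the
closure of VP_ws (equivalently: the polynomial Mulmuley–Sohoni conjecture T already implies VP ≠
VNP). [difficulty: XL] (why it might fail: VP ⊄ closure(VBP) is widely believed (IMM/det-type
separations), leaving only an algebraic Karp–Lipton VP=VNP ⟹ VBP=VNP, for which no mechanism is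
known; then P2 is true only because S is.) [arXiv:2102.07173, BringmannIkenmeyerZuiddam2018,
arXiv:1605.02815, BurgisserEtAl2011]
#4 CollapseDebordersIntoCircuits (crux) — P3 — under the collapse VP = VNP every family in the
closure of VP_ws on p-bounded variable sets is p-computable (equivalently: a superpolynomial circuit
lower bound for some border-determinantal family already implies VP ≠ VNP); implied by the
unconditional "closure of VP_ws ⊆ VNP" (GMQ16 programme: VP_ws* ⊆ VNP proved; residual closure ⊆
VP_ws*). [difficulty: L] (why it might fail: Mulmuley expects no general succinct (p-definable)
degeneration scheme for boundary points in non-closed orbits (GMQ16 §1.2); then closure(VP_ws) ⊆ VNP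
may be false and P3 holds only via the collapse or via S.) [arXiv:1605.02815, arXiv:2411.03444,
DuttaDwivediSaxena2021, BurgisserEtAl2011]
#5 CollapseDebordersCircuitsIntoDet (crux) — P4 — under the collapse VP = VNP, a p-computable family
on p-bounded variable sets that lies in the closure of VP_ws lies in VP_ws (equivalently: a
superpolynomial determinantal lower bound for a circuit-easy border-determinantal family already
implies VP ≠ VNP); implied by D (BLMW Question 9.4.2 affirmative via the discharged Prop 9.4.3).
[difficulty: XL] (why it might fail: approximation may be genuinely necessary for determinants at
polynomial width even for circuit-easy families (the width-2 phenomenon closure(VBP₂) = closure(VF)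
⊋ VBP₂ scaled up); then P4 is true only because S is.) [BurgisserEtAl2011,
BringmannIkenmeyerZuiddam2018, arXiv:2003.04834, arXiv:1605.02815]

TWO-LAYER PLAN. P3 — TYPED NEXT RUNG (v2): R3 = `BorderDepthThreeInVNP` (closure of poly-size
depth-three ΣΠΣ with unbounded top fan-in ⊆ VNP; DuttaDwivediSaxena2021 §1.1 open question after Thm
1.1; Dutta–Lysikov arXiv:2510.13049 §4.4.2 OQ5), strictly between the printed rung (constant top
fan-in into VBP, tree `DDS2021_thm_3_2`) and U3 = closure(VP_ws) ⊆ VNP by kernel-checked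
implications U3 → R3hi (closure(VP_e) ⊆ VNP) → R3 → R3lo (top fan-in ≤ log₂ n + 1); skeleton
`p3_of_nextRung : R3 → (R3 → R3hi) → (R3hi → U3) → P3` with the two lifts as declared-residual stubs
(registered by the writer as Lines/birth.lean after birth, not as route items — R3 is not implied by
S). Succinctness axis (alternative, IDEA-NEEDED): P3 ⇐ (closure(VP_ws) ⊆ VP_ws* : every
border-determinantal family is a p-DEFINABLE one-parameter degeneration of determinants, GMQ16
Question 4.4(4)) → (VP_ws* ⊆ VNP : GMQ16 Thm 6 analogue for VP_ws, to be typed as a Literature fact)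
→ P3; foreseen once the notions `IsPDefinableDegeneration` / VP_ws* are typed. P1 ⇐ (dc-ladder
rungs: dc(per_m) ≥ m²/2 in tree; target superpolynomial) is the exact per/det line and is NOT split
here.

KILL CRITERIA. A proof of per ∈ closure(VP_ws) (¬T) together with D refutes P1 and kills the line
(and GCT); a proof that some explicit VNP family is outside closure(VP_ws) under VP = VNP is
impossible to state — P2–P4 are refutable only by refuting S itself, so the route is closed
`exhausted`, not `refuted`, if P3's unconditional line (closure(VP_ws) ⊆ VNP) is refuted AND no
collapse-powered mechanism appears within the tenure window. Proved elsewhere: DcPerSuperpolynomial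
ℂ (VBP ≠ VNP) moots P1; BorderDcPerSuperpolynomial moots P1 and turns P2 into the whole summit
(pivot to P2's Karp–Lipton line).

NOT DECOMPOSED YET. The VP_ws* / p-definable-degeneration layer under P3 (needs two definitions);
the order-of-approximation route to D under P4 (tree `BLMW2011_prop_9_4_3_of_orderBound` turns any
polynomial order bound into D); the border ABP-chasm VP ⊆ closure(VBP) as a sufficient line for P2.
All are layer-2 children, filed when a crux closes or a definition lands.

CHEAPEST FALSIFIER. Lookup: is "closure(VP_ws) ⊄ VNP" or "VP ⊄ closure(VP_ws)" a theorem in print?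
(searched 2026-08-29: corpus fts+vec and galaxy — no; GMQ16 p.3 "not even known if closure(VP) ⊆
VNP", IS21 p.3 "major open question whether VBP = closure(VBP)"). In-tree: `ledger negatives` has no
closure-class statement; BC-style probe of each piece against S is pointless by construction (each
piece is implied by S: `p1_of_vh`…`p4_of_vh` kernel-checked) — the informative probe is the
converse, and no tree theorem gives Pi → S (grep of Theses/Theorems for IsVPwsBarFamily: only
Literature facts).

NUMBERS. dc(per_m) ≥ m²/2 (MignonRessayre2004; tree MignonRessayreBound); border dc(per_m) ≥ m²/2
(LandsbergManivelRessayre2013 Thm 1.1.1; tree BorderDcQuadraticBound); closure(VBP₂) = closure(VF) ⊋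
VBP₂ (BringmannIkenmeyerZuiddam2018); closure(Σ^[k]ΠΣ) ⊆ VBP (DuttaDwivediSaxena2021 Thm 1; tree
DDS2021_thm_3_2); BLMW Thm 9.4.4 error-degree bound (tree, discharged); GCT occurrence no-go n ≥
m^25 (BurgisserIkenmeyerPanova2019).

DEFINITION REQUESTS. `IsPDefinableDegeneration` (GMQ16 §3: one-parameter degeneration of exponential
degree with circuit-encoded coefficients) and the class predicate VP_ws* — topic
Literature/Computability/AlgebraicComplexity; wanted for the layer-2 split of P3. Cite fact wanted:
GMQ16 Thm 6 / Thm 1 analogue for VP_ws ("VP_ws* ⊆ VNP").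

Novelty: Searches (2026-08-29): lit search --hybrid "Mulmuley Sohoni conjecture would imply VP_ws ≠ VNP …
approximation" (8 docs: BCS97, arXiv:2411.03444, GMQ16 …); lit search '"VP = VNP" closure border' (3
hits: arXiv:2003.04834, arXiv:1710.03214, arXiv:2102.07173); lit vsearch "Is VP contained in the
closure of VBP …" (10 irrelevant books); lit galaxy search "if VP = VNP then|VP = VNP implies|VP =
VNP would imply" --star pdf (0 hits); "VP equals VNP|VNP collapses|collapse of VNP|VNP = VP" --star
pdf (5 hits, none relevant); earlier this session: galaxy "closure of VP|approximative closure|Kempf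
one-parameter" --star pdf (DDS21 full version found), rg over 77 Theses files for
IsVPwsBarFamily|IsVPBarFamily|BLMW2011_question_9_4_2 (0 items).
Nearest prior art found: arXiv:1605.02815 (GMQ16: VP vs closure(VP), Thm 1, Question 4.4 — the
engine under P3, aimed at VP ≠ closure(VP), not at a summit decomposition); Dutta–Dwivedi–Saxena
2021 p.4 remark "if VP = closure(VP) any proof of VP≠VNP shows VNP ⊄ closure(VP)" (= necessity of
P1-type pieces); arXiv:2102.07173 p.3 (T is a strengthening of VBP≠VNP; ¬T kills GCT not Valiant);
tree BLMW11 §9.3–9.4 facts.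
Delta: the debordering question is used as a HYPOTHESIS that splits VP≠VNP into four necessary,
individually-open transfer statements (S ⟺ P1∧P2∧P3∧P4), with GMQ16's degeneration theorems re-read
as rungs of the collapse-propagation piece P3 — a combination absent from GMQ16/DDS21/BLMW, which
target closure questions or border lower bounds  [refs: 2411.03444, 2003.04834, 1710.03214, 2102.07173, 1605.02815]

Barriers (technique_class: closure-classes, collapse-propagation, debordering): - technique_class: closure-classes, collapse-propagation, debordering
- Literature.Barriers.ValiantsHypothesis.AlgebraicNaturalProofs: bites a rank-method proof of P1′'s
exact content given D⁺ (a circuit lower bound for per; FSV/KRST, VNP-only in print; tree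
not_exists_isNaturalProof_of_succinct); P2, P3 are implications FROM the collapse (Karp–Lipton
shape), outside the natural-proofs class.
- catalogued module Literature/Barriers/ValiantsHypothesis/BDGIL24BorderClassInvariance.lean (decls
BergEtAl2024.vanishingIdealSeq_borderMeasure,
BergEtAl2024.hasAlgebraicNaturalProofs_borderMeasure_iff; cite correction T2 r1 C3): I(closure C) =
I(C) — equations cannot see the gap between VBP and its closure, so road (ii) of P1′ (¬D⁺: a VBP̄
family outside VP) can never be certified by equations/metapolynomials and sits INSIDE this barrier
with no evasion (filed honestly; T4 placed-judge); ¬D⁺ would need an explicit family plus a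
non-equational circuit lower bound; P3's engine is constructive (de-bordering / succinct
degenerations), not equational.
- Literature.Barriers.ValiantsHypothesis.GCTOccurrenceObstructions: BIP19 no-occurrence (tree
not_occurrenceObstructionRoute, not_occurrenceObstructionRouteQP) bites road (i) of P1′ for m ≥
n^25; the filed evasion is BY OBJECT (multiplicity obstructions in the polynomial window,
stub_obstructionWindow of births_v3.lean); P2, P3 use no obstructions.
- catalogued module Literature/Barriers/ValiantsHypothesis/CKRST20ApproximativeHardness.lean (na

History (route lifecycle, newest last):
- 2026-08-29T18:57:24Z · rev 3: restated Assembly (stmt-ValiantsHypothesis-23567) — v3: Assembly record follows the new closes (P1′ → P2 → P3 → S); the v2 assembly P1 → P2 → P3 → P4 → S remains provable (v2 closes) but is no longer the route's (planner-decomp-val-writer-1-g0-0)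
- 2026-08-29T19:58:56Z · rev 9: informal re-worded for CollapseDebordersIntoCircuits (planner-decomp-val-writer-1-g0-0)
- 2026-08-29T19:59:48Z · rev 10: informal re-worded for PerNotInBorderConstFaninEps (planner-decomp-val-writer-1-g0-0)
- 2026-08-30T23:56:03Z · RESIDUAL declared: CollapseToBorderDet (stmt-ValiantsHypothesis-23564) — summit-strength until shown otherwise: D-0170 flag now live (gate #11): declared residual conjunct of record for this route — tribunal_fit.residual = [Collapse (planner-decomp-val-writer-1-g5-0)

sub-problem: ValiantsHypothesis · status: draft · opened planner-decomp-val-writer-1-g0-0 2026-08-29T18:28:57Z · rev 12 · ledger route-ValiantsHypothesis-DecompCycle1C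
GENERATED by the gate from the ledger (D-0016/17). Provers cite these decls: `theorem foo : Summit.ValiantsHypothesis.ValiantsHypothesis.Theses.DecompCycle1C.<Decl> := …` in Summits/ValiantsHypothesis/ValiantsHypothesis/Theorems/<Name>.lean.
-/

namespace Summit.ValiantsHypothesis.ValiantsHypothesis.Theses.DecompCycle1C

open scoped BigOperators Topology Manifold Classical MeasureTheory ProbabilityTheory Matrix InnerProductSpace ComplexConjugate ContinuousMap
open Filter Set Function TopologicalSpace MeasureTheory

attribute [summit_statement] _root_.ValiantsHypothesis

open Literature.PNP

/-- item stmt-ValiantsHypothesis-23599 · crux · rank 2 · open · by planner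
why it might fail: irrefutable short of per ∈ VBP̄ ∧ D⁺; it fails to CLOSE: given D⁺ its content is a superpolynomial CIRCUIT lower bound for per (road T capped by BIP19 no-occurrence at m ≥ n^25; road ¬D⁺ has no candidate family).
sources: BurgisserEtAl2011, arXiv:2102.07173, arXiv:1605.02815, BurgisserIkenmeyerPanova2019, arXiv:2510.13049
[crux] P1′ — circuit-debordered Mulmuley–Sohoni: if every family in the closure of VP_ws on
p-bounded variable sets is p-computable (D⁺) then VNP ⊄ closure of VP_ws; ⟺ T ∨ ¬D⁺ ⟺ ¬(VNP ⊆
closure(VP_ws) ⊆_pbdd VP). why it might fail: irrefutable short of per ∈ VBP̄ ∧ D⁺; it fails to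
CLOSE: given D⁺ its content is a superpolynomial CIRCUIT lower bound for per (road T capped by BIP19
no-occurrence at m ≥ n^25; road ¬D⁺ has no candidate family). sources: BurgisserEtAl2011,
arXiv:2102.07173, arXiv:1605.02815, BurgisserIkenmeyerPanova2019, arXiv:2510.13049 -/
@[route_item "route-ValiantsHypothesis-DecompCycle1C", crux (bottleneck := work) (experiment := "instrument: writer g5 (route lead; gate #11): leaf tags of record TREE N2, critic CLEARED 18:15:32Z/18:55:31Z, tribunal J r1 19:26:52Z: P1' INSTRUMENTABLE (finite GCT/exact-dc rungs), P2 IDEA-NEEDED, P3 ATTACKAB…") (source := "ledger D-0171 leaf tag INSTRUMENTABLE on stmt-ValiantsHypothesis-23599 + ledger leaf_tag on stmt-ValiantsHypothesis-23599, 2026-09-01")]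
def CircuitDeborderedMulmuleySohoni : Prop :=
  (∀ (v : ℕ → ℕ) (f : ∀ n, MvPolynomial (Fin (v n)) ℂ), Literature.Computability.AlgebraicComplexity.IsPBounded v → Literature.Computability.AlgebraicComplexity.IsVPwsBarFamily f → Literature.Computability.AlgebraicComplexity.IsPComputable f) → ¬ (∀ (v : ℕ → ℕ) (f : ∀ n, MvPolynomial (Fin (v n)) ℂ), Literature.Computability.AlgebraicComplexity.IsVNPFamily f → Literature.Computability.AlgebraicComplexity.IsVPwsBarFamily f)

/-- item stmt-ValiantsHypothesis-23564 · crux · RESIDUAL (gen 0; summit-strength until shown otherwise, D-0170) · rank 3 · open · by planner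
why it might fail: VP ⊄ closure(VBP) is widely believed (IMM/det-type separations), leaving only an algebraic Karp–Lipton VP=VNP ⟹ VBP̄ ⊇ VNP, for which no mechanism is known; then P2 is true only because S is.
sources: arXiv:2102.07173, BringmannIkenmeyerZuiddam2018, arXiv:1605.02815, BurgisserEtAl2011
[crux] P2 — under the collapse VP = VNP every VNP family lies in the closure of VP_ws (equivalently:
the polynomial Mulmuley–Sohoni conjecture T already implies VP ≠ VNP). [difficulty: XL] -/
@[route_item "route-ValiantsHypothesis-DecompCycle1C", crux (bottleneck := idea) (source := "ledger wanted_by.residual on stmt-ValiantsHypothesis-23564, 2026-09-01")]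
def CollapseToBorderDet : Prop :=
  Literature.Computability.AlgebraicComplexity.VP ℂ = Literature.Computability.AlgebraicComplexity.VNP ℂ → ∀ (v : ℕ → ℕ) (f : ∀ n, MvPolynomial (Fin (v n)) ℂ), Literature.Computability.AlgebraicComplexity.IsVNPFamily f → Literature.Computability.AlgebraicComplexity.IsVPwsBarFamily f

/-- item stmt-ValiantsHypothesis-23565 · crux · rank 4 · open · by planner
why it might fail: Mulmuley expects no general succinct (p-definable) degeneration scheme for boundary points in non-closed orbits (GMQ16 §1.2); then closure(VP_ws) ⊆ VNP may be false and P3 holds only via the collapse or via S.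
sources: arXiv:1605.02815, arXiv:2411.03444, DuttaDwivediSaxena2021, BurgisserEtAl2011, arXiv:2510.13049
[crux] P3 — under the collapse VP = VNP every family in the closure of VP_ws on p-bounded variable
sets is p-computable (equivalently: a superpolynomial CIRCUIT lower bound for some
border-determinantal family already implies VP ≠ VNP); implied by the unconditional U3 "closure of
VP_ws ⊆ VNP", a NAMED open inclusion (BLMW11 p.21 L35 'It is not known whether or not the closure of
VP_ws is contained in VNP'; GMQ16 p.3 L21; GMQ16 programme: VP_ws* ⊆ VNP proved, residual closure ⊆
VP_ws*). Unconditional rung ladder R2 ≺ R3lo ≺ R3 ≺ U3: R2 = constant-top-fan-in border depth-three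
(p-bounded product fan-in, p-bounded variable sets) ⊆ VBP (DDS21 Thm 1.1 / Thm 3.2, tree
DDS2021_thm_3_2_holds) is KERNEL-PROVED in the node's Zariski rendering (lens-3 v4 r2_holds, via the
proved bridges EpsOfZariskiSPS and VPwsOfUABP); R3 = closure of poly-size ΣΠΣ (unbounded top fan-in)
⊆ VNP and R3lo (top fan-in ≤ log₂ n + 1) are NOT posed verbatim in print — they sit between the
printed questions Dutta–Lysikov arXiv:2510.13049 §4.4.2 OQ5 ('Is the closure of ΣΠΣ(log log n)
contained in VBP?') / OQ6 (exponential lower bound for the closure of ΣΠΣ(o(n))) and DDS21 p.6 (k =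
Θ(log s) → subexponential ABP?) on o -/
@[route_item "route-ValiantsHypothesis-DecompCycle1C", crux (bottleneck := idea) (source := "ledger wanted_by.residual on stmt-ValiantsHypothesis-23565, 2026-09-01")]
def CollapseDebordersIntoCircuits : Prop :=
  Literature.Computability.AlgebraicComplexity.VP ℂ = Literature.Computability.AlgebraicComplexity.VNP ℂ → ∀ (v : ℕ → ℕ) (f : ∀ n, MvPolynomial (Fin (v n)) ℂ), Literature.Computability.AlgebraicComplexity.IsPBounded v → Literature.Computability.AlgebraicComplexity.IsVPwsBarFamily f → Literature.Computability.AlgebraicComplexity.IsPComputable f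

/-- item stmt-ValiantsHypothesis-23563 · aside · rank 2 · open · by planner
why it might fail: it cannot be refuted short of per ∈ VBP; it fails to CLOSE because given D its content is Valiant's exact per/det conjecture (dc(per_m) superpolynomial; best known m²/2, Mignon–Ressayre).
sources: BurgisserEtAl2011, arXiv:0907.2850, MignonRessayre2004, arXiv:1605.02815
[crux] P1 — if approximation is unnecessary for determinants on p-bounded variable sets (closure of
VP_ws ⊆ VP_ws) then VNP ⊄ closure of VP_ws (class form of the Mulmuley–Sohoni conjecture in
polynomial form; ⟺ per ∉ closure of VP_ws by the proved BLMW Prop. 9.3.2, tree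
`borderDcPerSuperpolynomial_iff_not_vnp_subset_vpwsBar`). [difficulty: open-problem] -/
@[route_item "route-ValiantsHypothesis-DecompCycle1C"]
def DeborderedMulmuleySohoni : Prop :=
  (∀ (v : ℕ → ℕ) (f : ∀ n, MvPolynomial (Fin (v n)) ℂ), Literature.Computability.AlgebraicComplexity.IsPBounded v → Literature.Computability.AlgebraicComplexity.IsVPwsBarFamily f → Literature.Computability.AlgebraicComplexity.IsVPwsFamily f) → ¬ (∀ (v : ℕ → ℕ) (f : ∀ n, MvPolynomial (Fin (v n)) ℂ), Literature.Computability.AlgebraicComplexity.IsVNPFamily f → Literature.Computability.AlgebraicComplexity.IsVPwsBarFamily f)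

/-- item stmt-ValiantsHypothesis-23566 · aside · rank 5 · open · by planner
why it might fail: approximation may be genuinely necessary for determinants at polynomial width even for circuit-easy families (the width-2 phenomenon closure(VBP₂) = closure(VF) ⊋ VBP₂ scaled up); then P4 is true only because S is.
sources: BurgisserEtAl2011, BringmannIkenmeyerZuiddam2018, arXiv:2003.04834, arXiv:1605.02815
[crux] P4 — under the collapse VP = VNP, a p-computable family on p-bounded variable sets that lies
in the closure of VP_ws lies in VP_ws (equivalently: a superpolynomial determinantal lower bound for
a circuit-easy border-determinantal family already implies VP ≠ VNP); implied by D (BLMW Question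
9.4.2 affirmative via the discharged Prop 9.4.3). [difficulty: XL] -/
@[route_item "route-ValiantsHypothesis-DecompCycle1C"]
def CollapseDebordersCircuitsIntoDet : Prop :=
  Literature.Computability.AlgebraicComplexity.VP ℂ = Literature.Computability.AlgebraicComplexity.VNP ℂ → ∀ (v : ℕ → ℕ) (f : ∀ n, MvPolynomial (Fin (v n)) ℂ), Literature.Computability.AlgebraicComplexity.IsPBounded v → Literature.Computability.AlgebraicComplexity.IsPComputable f → Literature.Computability.AlgebraicComplexity.IsVPwsBarFamily f → Literature.Computability.AlgebraicComplexity.IsVPwsFamily f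

/-- item stmt-ValiantsHypothesis-23622 · aside · rank 9 · closed · proved by Summit.ValiantsHypothesis.ValiantsHypothesis.Theorems.DecompCycle1CPerBorderConstDepth.perNotInBorderConstFaninEps_holds (planner) · by planner
[aside · S-case for BC5/T3] the summit restricted to the regime of P3's proved rung R2 (DDS21 Thm
1.1; tree DDS2021_thm_3_2_holds; R2 itself kernel-proved in the Zariski rendering by lens-3 v4
r2_holds): the permanent family is not in the approximative closure of Σ^[k₀]ΠΣ with p-bounded
product fan-in, for any constant top fan-in k₀ (ε-form, DDS Def. 2.1). IN PRINT FOR THE DETERMINANT: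
Dutta–Saxena FOCS 2022 Thm 2 = Dutta–Lysikov arXiv:2510.13049 Thm 60 ('any ΣΠΣ(k)-bar circuit
computing an n × n symbolic determinant requires exp(n) size'); for the PERMANENT it follows in one
line — det_n is a p-projection of per_{t(n)} by VNP-completeness (Valiant 1979, char ≠ 2) and
border-ΣΠΣ(k₀) classes are closed under projections — a line that is not verbatim in print (T2 r1
C2). NOT in the tree; banked context, never staffed. The rung R2 (a containment of a border class in
VBP) is not a corollary of this lower bound. -/
@[route_item "route-ValiantsHypothesis-DecompCycle1C"]
def PerNotInBorderConstFaninEps : Prop :=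
  ∀ k₀ : ℕ, ¬ ∃ d : ℕ → ℕ, Literature.Computability.AlgebraicComplexity.IsPBounded d ∧ ∀ n : ℕ, MvPolynomial.rename (finProdFinEquiv (m := n) (n := n)) (Literature.Computability.AlgebraicComplexity.perPoly (Fin n) ℂ) ∈ Literature.Computability.AlgebraicComplexity.DDS2021.border (Literature.Computability.AlgebraicComplexity.DDS2021.spsClass (RatFunc ℂ) (n * n) k₀ (d n))

-- `PerNotInBorderConstFaninEps` holds: proved by `Summit.ValiantsHypothesis.ValiantsHypothesis.Theorems.DecompCycle1CPerBorderConstDepth.perNotInBorderConstFaninEps_holds` (its module imports this route file, so no `_holds` link can be stated here).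

/-- item stmt-ValiantsHypothesis-23713 · aside · rank 9 · closed · proved by Summit.ValiantsHypothesis.ValiantsHypothesis.Theorems.DecompCycle1CBorderConstFaninR2.borderConstFaninDepthThreeInVBP_holds (planner) · by planner
[aside · rung R2 of residual P3's unconditional ladder R2 ≺ R3lo ≺ R3 ≺ U3; PROVED IN THE TREE:
DDS2021.isVPwsFamily_of_isBorderSPSFamily_const (DDS21 Thm 1.1 read in the Zariski/VP_ws currency
via the landed bridges EpsZariski.epsOfZariskiSPS (p741858) + UABPWs.vpwsOfUABP (p741857) +
DDS2021_thm_3_2_holds; module DDS21ZariskiBorderConstFaninVBP p742035, lens decomp-val-lens-3 g3):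
for every constant top fan-in k₀, every p-bounded-variable family in the Zariski closure of
Σ^[k₀]Π^[d]Σ with p-bounded d is in VP_ws. Banked context, record-only per tribunal J r1
what_would_move_it (iii); never staffed (kind aside, bc6). A prover closes it with the one-liner
`theorem borderConstFaninDepthThreeInVBP_holds : BorderConstFaninDepthThreeInVBP :=
Literature.Computability.AlgebraicComplexity.DDS2021.isVPwsFamily_of_isBorderSPSFamily_const` in
Theorems/DecompCycle1CBorderConstFaninR2.lean (EDIT-KIT_v4 §3). Its S-case
PerNotInBorderConstFaninEps (23622) is known in print (DS22 Thm 2 = DL25 Thm 60), so R2 is NOT a T3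
witness for P1′. Sources: DuttaDwivediSaxena2021 Thm 1.1 / Thm 3.2; arXiv:2510.13049 (Dutta–Lysikov)
§4.4. -/
@[route_item "route-ValiantsHypothesis-DecompCycle1C"]
def BorderConstFaninDepthThreeInVBP : Prop :=
  ∀ (k₀ : ℕ) (v : ℕ → ℕ) (f : ∀ n, MvPolynomial (Fin (v n)) ℂ), Literature.Computability.AlgebraicComplexity.IsPBounded v → (∃ d : ℕ → ℕ, Literature.Computability.AlgebraicComplexity.IsPBounded d ∧ Literature.Computability.AlgebraicComplexity.DDS2021.IsBorderSPSFamily (fun _ => k₀) d f) → Literature.Computability.AlgebraicComplexity.IsVPwsFamily f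

-- `BorderConstFaninDepthThreeInVBP` holds: proved by `Summit.ValiantsHypothesis.ValiantsHypothesis.Theorems.DecompCycle1CBorderConstFaninR2.borderConstFaninDepthThreeInVBP_holds` (its module imports this route file, so no `_holds` link can be stated here).

-- earlier Assembly (stmt-ValiantsHypothesis-23567, replaced 2026-08-29T18:57:24Z -> stmt-ValiantsHypothesis-23609): retired by None — DeborderedMulmuleySohoni → CollapseToBorderDet → CollapseDebordersIntoCircuits → CollapseDebordersCircuitsIntoDet → ValiantsHypothesis
/-- item stmt-ValiantsHypothesis-23609 · assembly · rank 1 · closed · proved by Summit.ValiantsHypothesis.ValiantsHypothesis.Theorems.DecompCycle1CAssembly.assembly_holds (planner) · by planner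
sources: BurgisserEtAl2011
[assembly] P1 → P2 → P3 → P4 → VP_ℂ ≠ VNP_ℂ. -/
@[route_item "route-ValiantsHypothesis-DecompCycle1C"]
def Assembly : Prop :=
  CircuitDeborderedMulmuleySohoni → CollapseToBorderDet → CollapseDebordersIntoCircuits → ValiantsHypothesis

-- `Assembly` holds: proved by `Summit.ValiantsHypothesis.ValiantsHypothesis.Theorems.DecompCycle1CAssembly.assembly_holds` (its module imports this route file, so no `_holds` link can be stated here).

/-! D-0027 §2.1 — DECIDING THEOREM (planner-authored via `route open/edit --closes-file`; by planner-decomp-val-writer-1-g0-0 2026-08-29T18:56:28Z):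
its hypotheses are this route's items and its conclusion the sub-problem Statement (glue_lint), and it elaborates with this file. -/

@[closes "route-ValiantsHypothesis-DecompCycle1C"] theorem closes (h₁ : CircuitDeborderedMulmuleySohoni) (h₂ : CollapseToBorderDet)
    (h₃ : CollapseDebordersIntoCircuits) : ValiantsHypothesis := by
  change Literature.Computability.AlgebraicComplexity.VP ℂ ≠
    Literature.Computability.AlgebraicComplexity.VNP ℂ
  intro hEq
  exact h₁ (h₃ hEq) (h₂ hEq)

end Summit.ValiantsHypothesis.ValiantsHypothesis.Theses.DecompCycle1C
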